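import Summits.AtomisticToContinuum.FouriersLaw.Theorems.BondHeatUncertaintyExtensiveSnapshotIrreversibilityTapDualityOddCorrector
import Summits.AtomisticToContinuum.FouriersLaw.Theorems.BondHeatUncertaintyExtensiveSnapshotIrreversibilityTotalGreenKuboCap
import Summits.AtomisticToContinuum.FouriersLaw.Theorems.BondHeatUncertaintyExtensiveSnapshotIrreversibilityOddCorrectorOfKuboCorrector

/-!
# Crux `ExtensiveSnapshotIrreversibility` (stmt-AtomisticToContinuum-9121), line `tap-duality-gk-time`:
the cubic odd Kubo-corrector bound S4k (hence S4o) FROM ANY `N`-UNIFORM GREEN–KUBO-TIME BOUND (bridges, lead c5)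

With the two fixed-`N` stubs of the line LANDED — S_A `stub_tapDualityOddCorrector` (tap duality
`(∫ uo² dμ_T)² ≤ ⟨u, J⟩_{μ_T} · GK(uo)`, p141654) and S_B `stub_totalGreenKuboCap` (conductance cap
`0 ≤ ⟨u, J⟩_{μ_T} ≤ γ T² (N−1)²`, p141379) — every `N`-uniform estimate of Green–Kubo-time type for the odd part
`uo = (u − u∘Θ)/2` of the Kubo corrector `u = ∫₀^∞ P_t J dt` of the total current becomes the cubic bound S4k
`∫ (u − u∘Θ)² dμ_T ≤ C·N³`, which the landed reduction `oddCorrectorBound_of_kuboCorrectorOddCubic` (p124332) turns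
into the crux's `N`-uniform stub S4o.  Proved here, sorry-free and unconditional in form:

* `kuboCorrectorOddCubic_of_oddCorrectorGreenKuboTime` — S_C (`GK(uo) ≤ C·N·∫uo²`, the line's registered
  `stub_oddCorrectorGreenKuboTime`, verbatim as hypothesis) ⟹ S4k with constant `4γT²·max C 0`
  (moment form: `m₂² ≤ m₁ m₃ ≤ γT²N² · C N m₂`);
* `kuboCorrectorOddCubic_of_conductanceRelative` — the WEAKER sufficient form S_C′
  (`∫ uo² ≤ C·N·⟨u, J⟩`, "the odd corrector costs at most `N` conductances") ⟹ S4k (needs S_B only);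
* `oddCorrectorBound_of_oddCorrectorGreenKuboTime` — S_C ⟹ S4o, by composition with p124332;
* closed registered forms `helper_cubicOfGreenKuboTime`, `helper_cubicOfConductanceRelative`.

References: Kundu–Dhar–Narayan 2009 (Green–Kubo at finite `N`); folklore (Cauchy–Schwarz for the positive
symmetrised resolvent `Γ = ½((−L)⁻¹ + (−L†)⁻¹)`).
-/

noncomputable section

namespace Summit.AtomisticToContinuum.FouriersLaw.Theorems.ExtensiveSnapshotIrreversibility.TapDuality

open MeasureTheory Filter Topology
open scoped ENNReal NNReal
open Literature.MathematicalPhysics.KineticTheory.HeatConduction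

/-- Real arithmetic of the tap-duality composition: `a² ≤ D·g`, `0 ≤ D ≤ cap`, `g ≤ C'·Nr·a`
(`a, cap, C', Nr ≥ 0`) give `a ≤ cap·C'·Nr`. [folklore] -/
theorem le_of_tapDuality_parts {a D g cap C' Nr : ℝ} (ha : 0 ≤ a) (h1 : a ^ 2 ≤ D * g) (h2 : 0 ≤ D)
    (h3 : D ≤ cap) (hcap : 0 ≤ cap) (hC' : 0 ≤ C') (hN : 0 ≤ Nr) (h4 : g ≤ C' * Nr * a) :
    a ≤ cap * C' * Nr := by
  have hM : 0 ≤ cap * C' * Nr := by positivity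
  have hDg : D * g ≤ cap * (C' * Nr * a) := by
    rcases le_or_gt 0 g with hg | hg
    · calc D * g ≤ cap * g := mul_le_mul_of_nonneg_right h3 hg
        _ ≤ cap * (C' * Nr * a) := mul_le_mul_of_nonneg_left h4 hcap
    · have h0 : D * g ≤ 0 := mul_nonpos_of_nonneg_of_nonpos h2 hg.le
      have h1' : 0 ≤ cap * (C' * Nr * a) := by positivity
      linarith
  have key : a ^ 2 ≤ (cap * C' * Nr) * a := by nlinarith [h1, hDg]
  by_contra hlt0
  have hlt : cap * C' * Nr < a := not_le.mp hlt0
  have hapos : 0 < a := lt_of_le_of_lt hM hlt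
  nlinarith [key, hapos, hlt]

/-- `∫ (u − u∘Θ)² = 4 ∫ ((u − u∘Θ)/2)²`. [folklore] -/
theorem integral_sub_flip_sq_eq_four_mul {N : ℕ} (μ : Measure (PhaseSpace N)) (u : PhaseSpace N → ℝ) :
    ∫ x, (u x - u (x.1, -x.2)) ^ 2 ∂μ = 4 * ∫ x, ((u x - u (x.1, -x.2)) / 2) ^ 2 ∂μ := by
  rw [← integral_const_mul]
  refine integral_congr_ae (Filter.Eventually.of_forall fun x => ?_)
  ring

/-- **S4k from a Green–Kubo-time bound (S_C ⟹ S4k).** If for every `T > 0` there is `C` with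
`GK(uo) ≤ C·N·∫ uo² dμ_T` for all `N ≥ 2` and all `L²(μ_T)` a.e.-limits `u` of the finite-horizon Kubo
integrals (`uo = (u − u∘Θ)/2`, `GK(uo) = ∫₀^∞ ⟨uo, P_t uo⟩_{μ_T} dt`), then `∫ (u − u∘Θ)² dμ_T ≤ 4γT²·max C 0 · N³`:
tap duality (S_A, landed) gives `(∫uo²)² ≤ ⟨u,J⟩·GK(uo)`, the conductance cap (S_B, landed) `⟨u,J⟩ ≤ γT²(N−1)²`.
[cite: KunduDharNarayan2009, eq. (9)] -/
theorem kuboCorrectorOddCubic_of_oddCorrectorGreenKuboTime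
    (hC : ∀ ω₂ lam β γ : ℝ, 0 < ω₂ → 0 < lam → 0 < β → 0 < γ → ∀ T : ℝ, 0 < T → ∃ C : ℝ,
      ∀ (N : ℕ) (u : PhaseSpace N → ℝ), 2 ≤ N →
        MemLp u 2 ((pinnedChain ω₂ lam β γ).gibbsMeasure N T) →
        (∀ᵐ x ∂((pinnedChain ω₂ lam β γ).gibbsMeasure N T),
          Tendsto (fun τ : ℝ => ∫ t in Set.Ioc (0 : ℝ) τ,
            (∫ y, (∑ i : Fin N, (pinnedChain ω₂ lam β γ).bondCurrent N i y)
              ∂((pinnedChain ω₂ lam β γ).transitionKernel N T T t.toNNReal x))) atTop (𝓝 (u x))) →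
        ∫ t in Set.Ioi (0 : ℝ), ∫ z, (u z - u (z.1, -z.2)) / 2 *
              (∫ y, (u y - u (y.1, -y.2)) / 2
                ∂((pinnedChain ω₂ lam β γ).transitionKernel N T T t.toNNReal z))
              ∂((pinnedChain ω₂ lam β γ).gibbsMeasure N T) ≤
          C * N * ∫ z, ((u z - u (z.1, -z.2)) / 2) ^ 2 ∂((pinnedChain ω₂ lam β γ).gibbsMeasure N T)) :
    ∀ ω₂ lam β γ : ℝ, 0 < ω₂ → 0 < lam → 0 < β → 0 < γ → ∀ T : ℝ, 0 < T → ∃ C : ℝ,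
      ∀ (N : ℕ) (u : PhaseSpace N → ℝ), 2 ≤ N →
        MemLp u 2 ((pinnedChain ω₂ lam β γ).gibbsMeasure N T) →
        (∀ᵐ x ∂((pinnedChain ω₂ lam β γ).gibbsMeasure N T),
          Tendsto (fun τ : ℝ => ∫ t in Set.Ioc (0 : ℝ) τ,
            (∫ y, (∑ i : Fin N, (pinnedChain ω₂ lam β γ).bondCurrent N i y)
              ∂((pinnedChain ω₂ lam β γ).transitionKernel N T T t.toNNReal x))) atTop (𝓝 (u x))) →
        ∫ x, (u x - u (x.1, -x.2)) ^ 2 ∂((pinnedChain ω₂ lam β γ).gibbsMeasure N T) ≤ C * (N : ℝ) ^ 3 := by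
  intro ω₂ lam β γ hω hl hβ hγ T hT
  obtain ⟨C, hC'⟩ := hC ω₂ lam β γ hω hl hβ hγ T hT
  refine ⟨4 * (γ * T ^ 2) * max C 0, fun N u hN hu hlim => ?_⟩
  obtain ⟨-, h1⟩ := stub_tapDualityOddCorrector ω₂ lam β γ hω hl hβ hγ T hT N u hN hu hlim
  obtain ⟨h2, h3⟩ := stub_totalGreenKuboCap ω₂ lam β γ hω hl hβ hγ T hT N u hN hu hlim
  have h4 := hC' N u hN hu hlim
  set μT := (pinnedChain ω₂ lam β γ).gibbsMeasure N T with hμT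
  set a : ℝ := ∫ z, ((u z - u (z.1, -z.2)) / 2) ^ 2 ∂μT with ha_def
  set D : ℝ := ∫ z, u z * (∑ i : Fin N, (pinnedChain ω₂ lam β γ).bondCurrent N i z) ∂μT with hD_def
  set g : ℝ := ∫ t in Set.Ioi (0 : ℝ), ∫ z, (u z - u (z.1, -z.2)) / 2 *
      (∫ y, (u y - u (y.1, -y.2)) / 2 ∂((pinnedChain ω₂ lam β γ).transitionKernel N T T t.toNNReal z))
      ∂μT with hg_def
  have ha : 0 ≤ a := integral_nonneg fun _ => sq_nonneg _
  have hN0 : (0 : ℝ) ≤ N := by positivity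
  have hcap : 0 ≤ γ * T ^ 2 * ((N : ℝ) - 1) ^ 2 := by positivity
  have h4' : g ≤ max C 0 * N * a :=
    (h4 : g ≤ C * N * a).trans (mul_le_mul_of_nonneg_right
      (mul_le_mul_of_nonneg_right (le_max_left C 0) hN0) ha)
  have hle : a ≤ γ * T ^ 2 * ((N : ℝ) - 1) ^ 2 * max C 0 * N :=
    le_of_tapDuality_parts ha h1 h2 h3 hcap (le_max_right C 0) hN0 h4'
  rw [integral_sub_flip_sq_eq_four_mul]
  have hm : 0 ≤ max C 0 := le_max_right C 0
  have hγT : 0 ≤ γ * T ^ 2 := by positivity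
  have hN2 : (2 : ℝ) ≤ N := by exact_mod_cast hN
  have hNm1 : ((N : ℝ) - 1) ^ 2 ≤ (N : ℝ) ^ 2 := by nlinarith [hN2]
  have hprod : γ * T ^ 2 * ((N : ℝ) - 1) ^ 2 * max C 0 * N ≤
      γ * T ^ 2 * (N : ℝ) ^ 2 * max C 0 * N := by
    have h := mul_le_mul_of_nonneg_left hNm1 hγT
    have hmn : 0 ≤ max C 0 * (N : ℝ) := mul_nonneg hm hN0
    calc γ * T ^ 2 * ((N : ℝ) - 1) ^ 2 * max C 0 * N
        = (γ * T ^ 2 * ((N : ℝ) - 1) ^ 2) * (max C 0 * N) := by ring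
      _ ≤ (γ * T ^ 2 * (N : ℝ) ^ 2) * (max C 0 * N) := mul_le_mul_of_nonneg_right h hmn
      _ = γ * T ^ 2 * (N : ℝ) ^ 2 * max C 0 * N := by ring
  calc 4 * a ≤ 4 * (γ * T ^ 2 * ((N : ℝ) - 1) ^ 2 * max C 0 * N) := by linarith
    _ ≤ 4 * (γ * T ^ 2 * (N : ℝ) ^ 2 * max C 0 * N) := by linarith
    _ = 4 * (γ * T ^ 2) * max C 0 * (N : ℝ) ^ 3 := by ring

/-- **S4k from the conductance-relative bound (S_C′ ⟹ S4k).** If `∫ uo² dμ_T ≤ C·N·⟨u, J⟩_{μ_T}` uniformly in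
`N ≥ 2` (the odd corrector costs at most `N` conductances; weaker than S_C by tap duality and log-convexity of
the `Γ`-moments), then the conductance cap S_B gives `∫ (u − u∘Θ)² dμ_T ≤ 4γT²·max C 0 · N³`.
[cite: KunduDharNarayan2009, eq. (9)] -/
theorem kuboCorrectorOddCubic_of_conductanceRelative
    (hC : ∀ ω₂ lam β γ : ℝ, 0 < ω₂ → 0 < lam → 0 < β → 0 < γ → ∀ T : ℝ, 0 < T → ∃ C : ℝ,
      ∀ (N : ℕ) (u : PhaseSpace N → ℝ), 2 ≤ N →
        MemLp u 2 ((pinnedChain ω₂ lam β γ).gibbsMeasure N T) →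
        (∀ᵐ x ∂((pinnedChain ω₂ lam β γ).gibbsMeasure N T),
          Tendsto (fun τ : ℝ => ∫ t in Set.Ioc (0 : ℝ) τ,
            (∫ y, (∑ i : Fin N, (pinnedChain ω₂ lam β γ).bondCurrent N i y)
              ∂((pinnedChain ω₂ lam β γ).transitionKernel N T T t.toNNReal x))) atTop (𝓝 (u x))) →
        ∫ z, ((u z - u (z.1, -z.2)) / 2) ^ 2 ∂((pinnedChain ω₂ lam β γ).gibbsMeasure N T) ≤
          C * N * ∫ z, u z * (∑ i : Fin N, (pinnedChain ω₂ lam β γ).bondCurrent N i z)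
            ∂((pinnedChain ω₂ lam β γ).gibbsMeasure N T)) :
    ∀ ω₂ lam β γ : ℝ, 0 < ω₂ → 0 < lam → 0 < β → 0 < γ → ∀ T : ℝ, 0 < T → ∃ C : ℝ,
      ∀ (N : ℕ) (u : PhaseSpace N → ℝ), 2 ≤ N →
        MemLp u 2 ((pinnedChain ω₂ lam β γ).gibbsMeasure N T) →
        (∀ᵐ x ∂((pinnedChain ω₂ lam β γ).gibbsMeasure N T),
          Tendsto (fun τ : ℝ => ∫ t in Set.Ioc (0 : ℝ) τ,
            (∫ y, (∑ i : Fin N, (pinnedChain ω₂ lam β γ).bondCurrent N i y)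
              ∂((pinnedChain ω₂ lam β γ).transitionKernel N T T t.toNNReal x))) atTop (𝓝 (u x))) →
        ∫ x, (u x - u (x.1, -x.2)) ^ 2 ∂((pinnedChain ω₂ lam β γ).gibbsMeasure N T) ≤ C * (N : ℝ) ^ 3 := by
  intro ω₂ lam β γ hω hl hβ hγ T hT
  obtain ⟨C, hC'⟩ := hC ω₂ lam β γ hω hl hβ hγ T hT
  refine ⟨4 * (γ * T ^ 2) * max C 0, fun N u hN hu hlim => ?_⟩
  obtain ⟨h2, h3⟩ := stub_totalGreenKuboCap ω₂ lam β γ hω hl hβ hγ T hT N u hN hu hlim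
  have h4 := hC' N u hN hu hlim
  set μT := (pinnedChain ω₂ lam β γ).gibbsMeasure N T with hμT
  set a : ℝ := ∫ z, ((u z - u (z.1, -z.2)) / 2) ^ 2 ∂μT with ha_def
  set D : ℝ := ∫ z, u z * (∑ i : Fin N, (pinnedChain ω₂ lam β γ).bondCurrent N i z) ∂μT with hD_def
  have hN0 : (0 : ℝ) ≤ N := by positivity
  have hm : 0 ≤ max C 0 := le_max_right C 0
  have h4' : a ≤ max C 0 * N * D :=
    (h4 : a ≤ C * N * D).trans (mul_le_mul_of_nonneg_right
      (mul_le_mul_of_nonneg_right (le_max_left C 0) hN0) h2)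
  have hN2 : (2 : ℝ) ≤ N := by exact_mod_cast hN
  have hNm1 : ((N : ℝ) - 1) ^ 2 ≤ (N : ℝ) ^ 2 := by nlinarith [hN2]
  have hγT : 0 ≤ γ * T ^ 2 := by positivity
  have hD : D ≤ γ * T ^ 2 * (N : ℝ) ^ 2 := h3.trans (mul_le_mul_of_nonneg_left hNm1 hγT)
  have hmn : 0 ≤ max C 0 * (N : ℝ) := mul_nonneg hm hN0
  rw [integral_sub_flip_sq_eq_four_mul]
  calc 4 * a ≤ 4 * (max C 0 * N * D) := by linarith
    _ ≤ 4 * (max C 0 * N * (γ * T ^ 2 * (N : ℝ) ^ 2)) := by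
        have := mul_le_mul_of_nonneg_left hD hmn
        linarith
    _ = 4 * (γ * T ^ 2) * max C 0 * (N : ℝ) ^ 3 := by ring

/-- **S4o from a Green–Kubo-time bound (S_C ⟹ S4o):** composition of
`kuboCorrectorOddCubic_of_oddCorrectorGreenKuboTime` with the landed reduction
`ClausiusBudget.oddCorrectorBound_of_kuboCorrectorOddCubic` (S4k ⟹ S4o, p124332): an `N`-uniform
Green–Kubo-time bound for the odd Kubo corrector yields `∫ (w − w∘Θ)² dμ_T ≤ C·N` for the McLennan corrector
`w`, i.e. the crux's whole `N`-uniform content. [cite: KunduDharNarayan2009, eq. (9)] -/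
theorem oddCorrectorBound_of_oddCorrectorGreenKuboTime
    (hC : ∀ ω₂ lam β γ : ℝ, 0 < ω₂ → 0 < lam → 0 < β → 0 < γ → ∀ T : ℝ, 0 < T → ∃ C : ℝ,
      ∀ (N : ℕ) (u : PhaseSpace N → ℝ), 2 ≤ N →
        MemLp u 2 ((pinnedChain ω₂ lam β γ).gibbsMeasure N T) →
        (∀ᵐ x ∂((pinnedChain ω₂ lam β γ).gibbsMeasure N T),
          Tendsto (fun τ : ℝ => ∫ t in Set.Ioc (0 : ℝ) τ,
            (∫ y, (∑ i : Fin N, (pinnedChain ω₂ lam β γ).bondCurrent N i y)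
              ∂((pinnedChain ω₂ lam β γ).transitionKernel N T T t.toNNReal x))) atTop (𝓝 (u x))) →
        ∫ t in Set.Ioi (0 : ℝ), ∫ z, (u z - u (z.1, -z.2)) / 2 *
              (∫ y, (u y - u (y.1, -y.2)) / 2
                ∂((pinnedChain ω₂ lam β γ).transitionKernel N T T t.toNNReal z))
              ∂((pinnedChain ω₂ lam β γ).gibbsMeasure N T) ≤
          C * N * ∫ z, ((u z - u (z.1, -z.2)) / 2) ^ 2 ∂((pinnedChain ω₂ lam β γ).gibbsMeasure N T)) :
    ∀ ω₂ lam β γ : ℝ, 0 < ω₂ → 0 < lam → 0 < β → 0 < γ →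
      (∀ (N : ℕ) (T_L T_R : ℝ), 0 < T_L → 0 < T_R → ∀ μ ν : Measure (PhaseSpace N),
        (pinnedChain ω₂ lam β γ).IsSteadyState N T_L T_R μ →
        (pinnedChain ω₂ lam β γ).IsSteadyState N T_L T_R ν → μ = ν) →
      ∀ T : ℝ, 0 < T → ∃ C : ℝ, ∀ (N : ℕ) (hN : 2 ≤ N),
        let P := pinnedChain ω₂ lam β γ
        let μT := P.gibbsMeasure N T
        let g : PhaseSpace N → ℝ := fun y =>
          γ / (2 * T ^ 2) * (y.2 ⟨0, by omega⟩ ^ 2 - y.2 ⟨N - 1, by omega⟩ ^ 2)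
        let Pg : ℝ → PhaseSpace N → ℝ := fun s z => ∫ y, g y ∂(P.transitionKernel N T T s.toNNReal z)
        let w : PhaseSpace N → ℝ := fun z => ∫ s in Set.Ioi (0 : ℝ), Pg s z
        ∫ z, (w z - w (z.1, -z.2)) ^ 2 ∂μT ≤ C * N :=
  ClausiusBudget.oddCorrectorBound_of_kuboCorrectorOddCubic
    (kuboCorrectorOddCubic_of_oddCorrectorGreenKuboTime hC)

/-- **Registered helper stub `helper_cubicOfGreenKuboTime`** (closed form of
`kuboCorrectorOddCubic_of_oddCorrectorGreenKuboTime`: S_C ⟹ S4k). [cite: KunduDharNarayan2009, eq. (9)] -/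
theorem helper_cubicOfGreenKuboTime :
    (∀ ω₂ lam β γ : ℝ, 0 < ω₂ → 0 < lam → 0 < β → 0 < γ → ∀ T : ℝ, 0 < T → ∃ C : ℝ,
      ∀ (N : ℕ) (u : PhaseSpace N → ℝ), 2 ≤ N →
        MemLp u 2 ((pinnedChain ω₂ lam β γ).gibbsMeasure N T) →
        (∀ᵐ x ∂((pinnedChain ω₂ lam β γ).gibbsMeasure N T),
          Tendsto (fun τ : ℝ => ∫ t in Set.Ioc (0 : ℝ) τ,
            (∫ y, (∑ i : Fin N, (pinnedChain ω₂ lam β γ).bondCurrent N i y)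
              ∂((pinnedChain ω₂ lam β γ).transitionKernel N T T t.toNNReal x))) atTop (𝓝 (u x))) →
        ∫ t in Set.Ioi (0 : ℝ), ∫ z, (u z - u (z.1, -z.2)) / 2 *
              (∫ y, (u y - u (y.1, -y.2)) / 2
                ∂((pinnedChain ω₂ lam β γ).transitionKernel N T T t.toNNReal z))
              ∂((pinnedChain ω₂ lam β γ).gibbsMeasure N T) ≤
          C * N * ∫ z, ((u z - u (z.1, -z.2)) / 2) ^ 2 ∂((pinnedChain ω₂ lam β γ).gibbsMeasure N T)) →
    ∀ ω₂ lam β γ : ℝ, 0 < ω₂ → 0 < lam → 0 < β → 0 < γ → ∀ T : ℝ, 0 < T → ∃ C : ℝ,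
      ∀ (N : ℕ) (u : PhaseSpace N → ℝ), 2 ≤ N →
        MemLp u 2 ((pinnedChain ω₂ lam β γ).gibbsMeasure N T) →
        (∀ᵐ x ∂((pinnedChain ω₂ lam β γ).gibbsMeasure N T),
          Tendsto (fun τ : ℝ => ∫ t in Set.Ioc (0 : ℝ) τ,
            (∫ y, (∑ i : Fin N, (pinnedChain ω₂ lam β γ).bondCurrent N i y)
              ∂((pinnedChain ω₂ lam β γ).transitionKernel N T T t.toNNReal x))) atTop (𝓝 (u x))) →
        ∫ x, (u x - u (x.1, -x.2)) ^ 2 ∂((pinnedChain ω₂ lam β γ).gibbsMeasure N T) ≤ C * (N : ℝ) ^ 3 :=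
  kuboCorrectorOddCubic_of_oddCorrectorGreenKuboTime

/-- **Registered helper stub `helper_cubicOfConductanceRelative`** (closed form of
`kuboCorrectorOddCubic_of_conductanceRelative`: S_C′ ⟹ S4k). [cite: KunduDharNarayan2009, eq. (9)] -/
theorem helper_cubicOfConductanceRelative :
    (∀ ω₂ lam β γ : ℝ, 0 < ω₂ → 0 < lam → 0 < β → 0 < γ → ∀ T : ℝ, 0 < T → ∃ C : ℝ,
      ∀ (N : ℕ) (u : PhaseSpace N → ℝ), 2 ≤ N →
        MemLp u 2 ((pinnedChain ω₂ lam β γ).gibbsMeasure N T) →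
        (∀ᵐ x ∂((pinnedChain ω₂ lam β γ).gibbsMeasure N T),
          Tendsto (fun τ : ℝ => ∫ t in Set.Ioc (0 : ℝ) τ,
            (∫ y, (∑ i : Fin N, (pinnedChain ω₂ lam β γ).bondCurrent N i y)
              ∂((pinnedChain ω₂ lam β γ).transitionKernel N T T t.toNNReal x))) atTop (𝓝 (u x))) →
        ∫ z, ((u z - u (z.1, -z.2)) / 2) ^ 2 ∂((pinnedChain ω₂ lam β γ).gibbsMeasure N T) ≤
          C * N * ∫ z, u z * (∑ i : Fin N, (pinnedChain ω₂ lam β γ).bondCurrent N i z)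
            ∂((pinnedChain ω₂ lam β γ).gibbsMeasure N T)) →
    ∀ ω₂ lam β γ : ℝ, 0 < ω₂ → 0 < lam → 0 < β → 0 < γ → ∀ T : ℝ, 0 < T → ∃ C : ℝ,
      ∀ (N : ℕ) (u : PhaseSpace N → ℝ), 2 ≤ N →
        MemLp u 2 ((pinnedChain ω₂ lam β γ).gibbsMeasure N T) →
        (∀ᵐ x ∂((pinnedChain ω₂ lam β γ).gibbsMeasure N T),
          Tendsto (fun τ : ℝ => ∫ t in Set.Ioc (0 : ℝ) τ,
            (∫ y, (∑ i : Fin N, (pinnedChain ω₂ lam β γ).bondCurrent N i y)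
              ∂((pinnedChain ω₂ lam β γ).transitionKernel N T T t.toNNReal x))) atTop (𝓝 (u x))) →
        ∫ x, (u x - u (x.1, -x.2)) ^ 2 ∂((pinnedChain ω₂ lam β γ).gibbsMeasure N T) ≤ C * (N : ℝ) ^ 3 :=
  kuboCorrectorOddCubic_of_conductanceRelative

end Summit.AtomisticToContinuum.FouriersLaw.Theorems.ExtensiveSnapshotIrreversibility.TapDuality

end
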